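import Literature.MathematicalPhysics.QuantumFieldTheory.Balaban1983to89.B6SectAVectorModelV1
import Literature.MathematicalPhysics.QuantumFieldTheory.Balaban1983to89.B5Eq121Form
import HarnessLib

/-!
# `Balaban1983to89.B6VecIMSV1` — T. Bałaban, *Propagators and renormalization transformations for lattice gauge theories. II*,
Commun. Math. Phys. **96** (1984) 223–250 [Balaban1984PropagatorsII], (2.19) p. 226 with [Balaban1984PropagatorsI] (1.21) p. 21:
**THE LOCALISED ENERGY IDENTITY FOR `Δ_a`** on the V1 multi-level torus calculus — for every vector field `A`, every fine-bond multiplier `χ`: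

  `Σ_ν Σ_b |c(χA)(b + e_ν) − c(χA)(b)|² = ⟨χ²A, Δ_aA⟩ + ⟨χ²A, ∂(1 − R)∂*A⟩ − ⟨Q(χ²A), aQA⟩ + Σ_ν Σ_b c²(χ(b+e_ν) − χ(b))²A(b)A(b+e_ν)`

(`ims_deltaAE`), the first brick of the interior-energy route to [B6] Prop. 2.6 (2.140)₄ `‖ζ∇G∇*J‖` at k levels (cell pub-ymgap, seat dag-p1, plan
`HOME/pub-ymgap-dag-p1/HL3-PLAN.md`; lit-balaban GAPS G-B6-2140-456, census slot hl3 of `B6Prop26PrintedStage2KLevelV1.prop26Printed_kLevel_of_slots5`).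
With `Δ_aA = ∇*_μJ` (i.e. `A = G∇*_μJ`) the first term is the SOURCE pairing `⟨∇_μ(χ²A), J⟩`; the other three are bounded by the tree's (2.88)
(`B6Dg288ChartV1`), the `ℓ²` size of `Q` (`B6Ineq2142KLevelV1.qwt_le`) and `|∇χ|²` — sequel files.

HONEST FRAMING (programme rule): statement-level skeleton of published theorems with citation tags; proofs where landed; nothing here is a claim
about the Yang–Mills mass gap.  Elementary lattice algebra (discrete product rule, summation by parts, polarisation of (1.21)); no estimate of print is
asserted; nothing continuum ∕ mass-gap ∕ Clay.  THEOREMS ONLY, no `def`.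

## WHAT IS PRINTED

[B6] p. 226 (2.19): «Δ_a = ∂*∂ + ∂R∂* + Q*aQ = Δ − ∂P∂* + Q*aQ»; [B5] p. 21 (1.21): «⟨∂A, ∂A⟩ = … = Σ_μ ⟨A_μ, ΔA_μ⟩ − ⟨∂*A, ∂*A⟩, where Δ is
η-lattice Laplace operator for scalar functions and ∂* is the divergence operator».  The identity of this file is the standard localisation
(«IMS») computation for `Δ = Σ_ν ∇*_ν∇_ν` acting componentwise, combined with (2.19) read as `⟨B, Δ_aA⟩ = ⟨∂B, ∂A⟩ + ⟨∂*B, ∂*A⟩ − ⟨B, ∂(1−R)∂*A⟩ +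
⟨QB, aQA⟩` and (1.21) polarised; it is not a display of print (an UNPRINTED STEP toward (2.140)₄, cf. GAPS G-B6-2140-456).

## WHAT THIS FILE PROVES (0 sorry; standard axioms; generic `P : Params`, level `j` where meaningful, every `Domains`, `c`, `w`)

* §1 **`sum_sq_pdiff_mul`** — scalar discrete IMS in one direction: `Σ_x (∂_ν(χf))² = Σ_x (χ²f)·(∂*_ν∂_νf) + Σ_x c²(χ(x+e_ν)−χ(x))² f(x)f(x+e_ν)`.
* §2 `sum_mul_laplace_eq_sum_pdiff` (`Σ_x g·Δf = Σ_ν Σ_x ∂_νg·∂_νf`), `pdiff_add'`, `laplace_add'`, `diverg_add'`, and the POLARISED (1.21)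
  **`sum_mul_laplace_eq_curl_add_diverg`**: `Σ_μ Σ_x B_μ·ΔA_μ = Σ_p (∂B)(p)(∂A)(p) + Σ_x (∂*B)(x)(∂*A)(x)` (from `B5Eq121Form.eq121` at `A`, `B`, `A + B`).
* §3 the Euclidean-space readings: `inner_curl_add_diverg` (`⟨∂B, ∂A⟩ + ⟨∂*B, ∂*A⟩` as those sums), **`inner_deltaAE_eq`**
  (`⟨B, Δ_aA⟩ = ⟨∂B,∂A⟩ + ⟨∂*B,∂*A⟩ − ⟨B, ∂(1−R)∂*A⟩ + ⟨QB, aQA⟩`).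
* §4 **`ims_deltaAE`** (the display above) and its corollary **`ims_deltaAE_le`**: `Σ_ν Σ_b (∇_ν(χA))(b)² ≤ |⟨χ²A, Δ_aA⟩| + |⟨χ²A, ∂(1−R)∂*A⟩| +
  |⟨Q(χ²A), aQA⟩| + c²·δ²·Σ_ν Σ_{b : χ(b+e_ν) ≠ χ(b)} |A(b)A(b+e_ν)|` for `|χ(b+e_ν) − χ(b)| ≤ δ`.

Seat `pub-ymgap-dag-p1` (prover), 2026-08-25.  NOT summit progress.
-/

open scoped InnerProductSpace BigOperators

namespace Literature.MathematicalPhysics.QuantumFieldTheory.Balaban1983to89.B6VecIMSV1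

open LatticeFieldCalculus B6SectADomainsV1 B6SectAOperatorsV1 B6SectAVectorModelV1 B5Eq121Form
open BalabanImbrieJaffe1984to88.BIJ85AxialPropagator411 (BondSpace PlaqSpace)

noncomputable section

variable {P : Params} {j : ℕ}

/-! ## §1  Scalar discrete IMS in one direction -/

/-- the pointwise identity behind the discrete IMS formula: `(c(χ′f′ − χf))² = c(χ′²f′ − χ²f)·c(f′ − f) + c²(χ′ − χ)²·f f′`. [folklore] -/
private theorem sq_pdiff_mul_point (c χ χ' f f' : ℝ) :
    (c * (χ' * f' - χ * f)) ^ 2 = (c * (χ' ^ 2 * f' - χ ^ 2 * f)) * (c * (f' - f)) + c ^ 2 * (χ' - χ) ^ 2 * (f * f') := by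
  ring

/-- **SCALAR DISCRETE IMS, ONE DIRECTION**: `Σ_x (∂_ν(χf))(x)² = Σ_x (χ²f)(x)·(∂*_ν∂_νf)(x) + Σ_x c²(χ(x+e_ν) − χ(x))² f(x)f(x+e_ν)` on the torus
`T^{(j)}` (product rule + summation by parts `LatticeFieldCalculus.sum_pdiff_mul`). [cite: Balaban1984PropagatorsI, (1.21) p.21 (the operators ∂_μ, ∂*_μ); folklore (IMS localisation)] -/
theorem sum_sq_pdiff_mul (c : ℝ) (ν : Fin P.d) (χ f : SiteField P j ℝ) :
    ∑ x, (pdiff c ν (fun z => χ z * f z) x) ^ 2 =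
      ∑ x, (χ x ^ 2 * f x) * pdiffAdj c ν (pdiff c ν f) x +
        ∑ x, c ^ 2 * (χ (x.shift ν) - χ x) ^ 2 * (f x * f (x.shift ν)) := by
  have h1 : ∀ x, (pdiff c ν (fun z => χ z * f z) x) ^ 2 =
      pdiff c ν (fun z => χ z ^ 2 * f z) x * pdiff c ν f x + c ^ 2 * (χ (x.shift ν) - χ x) ^ 2 * (f x * f (x.shift ν)) := by
    intro x
    simp only [pdiff, smul_eq_mul]
    ring
  rw [Finset.sum_congr rfl fun x _ => h1 x, Finset.sum_add_distrib, sum_pdiff_mul]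

/-! ## §2  `Σ g·Δf` as a gradient pairing, and the polarised (1.21) -/

/-- `Σ_x g(x)(Δf)(x) = Σ_ν Σ_x (∂_νg)(x)(∂_νf)(x)` (`Δ = Σ_ν ∂*_ν∂_ν`, summation by parts). [cite: Balaban1984PropagatorsI, (1.21) p.21] -/
theorem sum_mul_laplace_eq_sum_pdiff (c : ℝ) (g f : SiteField P j ℝ) :
    ∑ x, g x * laplace c f x = ∑ ν : Fin P.d, ∑ x, pdiff c ν g x * pdiff c ν f x := by
  simp_rw [laplace_apply, Finset.mul_sum]
  rw [Finset.sum_comm]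
  exact Finset.sum_congr rfl fun ν _ => (sum_pdiff_mul c ν g (pdiff c ν f)).symm

/-- `∂_ν(f + g) = ∂_νf + ∂_νg` pointwise. [cite: Balaban1984PropagatorsI, (1.2) p.18, bookkeeping] -/
theorem pdiff_add' (c : ℝ) (ν : Fin P.d) (f g : SiteField P j ℝ) (x : Site P j) :
    pdiff c ν (fun z => f z + g z) x = pdiff c ν f x + pdiff c ν g x := by
  simp only [pdiff, smul_eq_mul]; ring

/-- `Δ(f + g) = Δf + Δg` pointwise. [cite: Balaban1984PropagatorsI, (1.21) p.21, bookkeeping] -/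
theorem laplace_add' (c : ℝ) (f g : SiteField P j ℝ) (x : Site P j) :
    laplace c (fun z => f z + g z) x = laplace c f x + laplace c g x := by
  simp only [laplace, smul_eq_mul, ← Finset.sum_add_distrib]
  exact Finset.sum_congr rfl fun μ _ => by ring

/-- `∂*(A + B) = ∂*A + ∂*B` pointwise. [cite: Balaban1984PropagatorsI, (1.21) p.21, bookkeeping] -/
theorem diverg_add' (c : ℝ) (A B : VecField P j ℝ) (x : Site P j) :
    diverg c (fun b => A b + B b) x = diverg c A x + diverg c B x := by
  simp only [diverg, smul_eq_mul, ← Finset.sum_add_distrib]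
  exact Finset.sum_congr rfl fun μ _ => by ring

/-- `(∂(A + B))(p) = (∂A)(p) + (∂B)(p)`. [cite: Balaban1984PropagatorsI, (1.2) p.18, bookkeeping] -/
theorem curl_add' (c : ℝ) (A B : VecField P j ℝ) (p : Plaq P j) :
    curl c (fun b => A b + B b) p = curl c A p + curl c B p :=
  curl_add c A B p

/-- the quadratic form of (1.21) at weight `1`: `Σ_μ Σ_x A_μ·ΔA_μ = Σ_p (∂A)(p)² + Σ_x (∂*A)(x)²`. [cite: Balaban1984PropagatorsI, (1.21) p.21] -/
theorem sum_mul_laplace_self_eq (c : ℝ) (A : VecField P j ℝ) :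
    ∑ μ : Fin P.d, ∑ x, A ⟨x, μ⟩ * laplace c (fun z => A ⟨z, μ⟩) x =
      ∑ p : Plaq P j, curl c A p ^ 2 + ∑ x, diverg c A x ^ 2 := by
  have h := eq121 1 c A
  simp only [sitePairing, one_mul] at h
  have h2 : ∑ x, diverg c A x * diverg c A x = ∑ x, diverg c A x ^ 2 := Finset.sum_congr rfl fun x _ => by ring
  rw [h2] at h
  linarith

/-- **(1.21) POLARISED**: `Σ_μ Σ_x B_μ(x)·(ΔA_μ)(x) = Σ_p (∂B)(p)(∂A)(p) + Σ_x (∂*B)(x)(∂*A)(x)` for all vector fields `A, B` on `T^{(j)}` — the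
componentwise Laplacian IS `∂*∂ + ∂∂*` on the flat torus (both sides are symmetric bilinear forms agreeing on the diagonal by `B5Eq121Form.eq121`).
[cite: Balaban1984PropagatorsI, (1.21) p.21] -/
theorem sum_mul_laplace_eq_curl_add_diverg (c : ℝ) (B A : VecField P j ℝ) :
    ∑ μ : Fin P.d, ∑ x, B ⟨x, μ⟩ * laplace c (fun z => A ⟨z, μ⟩) x =
      ∑ p : Plaq P j, curl c B p * curl c A p + ∑ x, diverg c B x * diverg c A x := by
  -- the three diagonal instances
  have hA := sum_mul_laplace_self_eq c A
  have hB := sum_mul_laplace_self_eq c B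
  have hAB := sum_mul_laplace_self_eq c (fun b => A b + B b)
  -- expand the left of `hAB` by bilinearity and symmetry
  have hsymm : ∀ (f g : SiteField P j ℝ), ∑ x, g x * laplace c f x = ∑ x, f x * laplace c g x := by
    intro f g
    rw [sum_mul_laplace_eq_sum_pdiff, sum_mul_laplace_eq_sum_pdiff]
    exact Finset.sum_congr rfl fun ν _ => Finset.sum_congr rfl fun x _ => by ring
  have hL : ∑ μ : Fin P.d, ∑ x, (A ⟨x, μ⟩ + B ⟨x, μ⟩) * laplace c (fun z => A ⟨z, μ⟩ + B ⟨z, μ⟩) x =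
      (∑ μ : Fin P.d, ∑ x, A ⟨x, μ⟩ * laplace c (fun z => A ⟨z, μ⟩) x) +
        2 * (∑ μ : Fin P.d, ∑ x, B ⟨x, μ⟩ * laplace c (fun z => A ⟨z, μ⟩) x) +
        ∑ μ : Fin P.d, ∑ x, B ⟨x, μ⟩ * laplace c (fun z => B ⟨z, μ⟩) x := by
    have : ∀ μ : Fin P.d, ∑ x, (A ⟨x, μ⟩ + B ⟨x, μ⟩) * laplace c (fun z => A ⟨z, μ⟩ + B ⟨z, μ⟩) x =
        (∑ x, A ⟨x, μ⟩ * laplace c (fun z => A ⟨z, μ⟩) x) + 2 * (∑ x, B ⟨x, μ⟩ * laplace c (fun z => A ⟨z, μ⟩) x) +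
          ∑ x, B ⟨x, μ⟩ * laplace c (fun z => B ⟨z, μ⟩) x := by
      intro μ
      have hs := hsymm (fun z => B ⟨z, μ⟩) (fun z => A ⟨z, μ⟩)
      simp only [laplace_add' c (fun z => A ⟨z, μ⟩) (fun z => B ⟨z, μ⟩)]
      have e : ∀ x, (A ⟨x, μ⟩ + B ⟨x, μ⟩) * (laplace c (fun z => A ⟨z, μ⟩) x + laplace c (fun z => B ⟨z, μ⟩) x) =
          A ⟨x, μ⟩ * laplace c (fun z => A ⟨z, μ⟩) x + (B ⟨x, μ⟩ * laplace c (fun z => A ⟨z, μ⟩) x +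
            A ⟨x, μ⟩ * laplace c (fun z => B ⟨z, μ⟩) x) + B ⟨x, μ⟩ * laplace c (fun z => B ⟨z, μ⟩) x := fun x => by ring
      simp only [e, Finset.sum_add_distrib]
      rw [hs]; ring
    simp only [this, Finset.sum_add_distrib, Finset.mul_sum]
  -- expand the right of `hAB`
  have hR : ∑ p : Plaq P j, curl c (fun b => A b + B b) p ^ 2 + ∑ x, diverg c (fun b => A b + B b) x ^ 2 =
      (∑ p : Plaq P j, curl c A p ^ 2 + ∑ x, diverg c A x ^ 2) +
        2 * (∑ p : Plaq P j, curl c B p * curl c A p + ∑ x, diverg c B x * diverg c A x) +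
        (∑ p : Plaq P j, curl c B p ^ 2 + ∑ x, diverg c B x ^ 2) := by
    simp only [curl_add', diverg_add']
    have e1 : ∀ p : Plaq P j, (curl c A p + curl c B p) ^ 2 = curl c A p ^ 2 + 2 * (curl c B p * curl c A p) + curl c B p ^ 2 :=
      fun p => by ring
    have e2 : ∀ x : Site P j, (diverg c A x + diverg c B x) ^ 2 = diverg c A x ^ 2 + 2 * (diverg c B x * diverg c A x) + diverg c B x ^ 2 :=
      fun x => by ring
    simp only [e1, e2, Finset.sum_add_distrib, ← Finset.mul_sum]
    ring
  rw [hL, hR, hA, hB] at hAB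
  linarith

/-! ## §3  The Euclidean-space readings -/

/-- `⟨∂B, ∂A⟩ + ⟨∂*B, ∂*A⟩` as the sums of §2 (plaquette variables and divergences of the underlying functions).
[cite: Balaban1984PropagatorsII, (2.5) p.224, (2.8) p.224] -/
theorem inner_curl_add_diverg (c : ℝ) (B A : BondSpace P) :
    ⟪dcE c B, dcE c A⟫_ℝ + ⟪dsE c B, dsE c A⟫_ℝ =
      ∑ p : Plaq P 0, curl c (WithLp.ofLp B) p * curl c (WithLp.ofLp A) p +
        ∑ x, diverg c (WithLp.ofLp B) x * diverg c (WithLp.ofLp A) x := by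
  rw [inner_eq_sum, inner_eq_sum]
  simp only [dcE_apply, dsE_apply]

/-- **(2.19) READ AS A BILINEAR FORM WITH `P = 1 − R` DISPLAYED**: `⟨B, Δ_aA⟩ = ⟨∂B, ∂A⟩ + ⟨∂*B, ∂*A⟩ − ⟨B, ∂(1 − R)∂*A⟩ + ⟨QB, aQA⟩`
(«Δ_a = Δ − ∂P∂* + Q*aQ»). [cite: Balaban1984PropagatorsII, (2.19) p.226] -/
theorem inner_deltaAE_eq (D : Domains P) (c : ℝ) (w : BondIdx D → ℝ) (B A : BondSpace P) :
    ⟪B, deltaAE D c w A⟫_ℝ = ⟪dcE c B, dcE c A⟫_ℝ + ⟪dsE c B, dsE c A⟫_ℝ -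
      ⟪B, (dE c ∘ₗ (LinearMap.id - RE D c) ∘ₗ dsE c) A⟫_ℝ + ⟪QE D B, aE D w (QE D A)⟫_ℝ := by
  rw [inner_deltaAE_right]
  have h : ⟪B, (dE c ∘ₗ (LinearMap.id - RE D c) ∘ₗ dsE c) A⟫_ℝ = ⟪dsE c B, dsE c A⟫_ℝ - ⟪dsE c B, RE D c (dsE c A)⟫_ℝ := by
    simp only [LinearMap.coe_comp, Function.comp_apply, LinearMap.sub_apply, LinearMap.id_apply]
    rw [real_inner_comm, inner_dE_left, real_inner_comm, inner_sub_right]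
  rw [h]; ring

/-! ## §4  The localised energy identity -/

/-- a sum over bonds is a double sum over sites and directions. [folklore] -/
private theorem sum_bond_eq' {α : Type*} [AddCommMonoid α] (F : PBond P j → α) :
    ∑ b : PBond P j, F b = ∑ x : Site P j, ∑ μ : Fin P.d, F ⟨x, μ⟩ :=
  calc ∑ b : PBond P j, F b = ∑ p : Site P j × Fin P.d, F (bondEquiv p) :=
        (Equiv.sum_comp (bondEquiv (P := P) (j := j)) F).symm
    _ = ∑ x : Site P j, ∑ μ : Fin P.d, F ⟨x, μ⟩ := Fintype.sum_prod_type _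

/-- **THE LOCALISED ENERGY IDENTITY FOR `Δ_a`** (every `Domains`, `c`, `w`, every vector field `A` and fine-bond multiplier `χ`):
`Σ_ν Σ_b (c((χA)(b+e_ν) − (χA)(b)))² = ⟨χ²A, Δ_aA⟩ + ⟨χ²A, ∂(1−R)∂*A⟩ − ⟨Q(χ²A), aQA⟩ + Σ_ν Σ_b c²(χ(b+e_ν) − χ(b))²A(b)A(b+e_ν)`,
where `χA`, `χ²A` are the pointwise products and `b + e_ν` the bond translated by `e_ν`. [cite: Balaban1984PropagatorsII, (2.19) p.226; Balaban1984PropagatorsI, (1.21) p.21; folklore (IMS localisation)] -/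
theorem ims_deltaAE (D : Domains P) (c : ℝ) (w : BondIdx D → ℝ) (A : BondSpace P) (χ : PBond P 0 → ℝ) :
    ∑ ν : Fin P.d, ∑ b : PBond P 0, (c * (χ ⟨b.src.shift ν, b.dir⟩ * A ⟨b.src.shift ν, b.dir⟩ - χ b * A b)) ^ 2 =
      ⟪(WithLp.toLp 2 fun b => χ b ^ 2 * A b : BondSpace P), deltaAE D c w A⟫_ℝ +
      ⟪(WithLp.toLp 2 fun b => χ b ^ 2 * A b : BondSpace P), (dE c ∘ₗ (LinearMap.id - RE D c) ∘ₗ dsE c) A⟫_ℝ -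
      ⟪QE D (WithLp.toLp 2 fun b => χ b ^ 2 * A b : BondSpace P), aE D w (QE D A)⟫_ℝ +
      ∑ ν : Fin P.d, ∑ b : PBond P 0, c ^ 2 * (χ ⟨b.src.shift ν, b.dir⟩ - χ b) ^ 2 * (A b * A ⟨b.src.shift ν, b.dir⟩) := by
  set B : BondSpace P := WithLp.toLp 2 fun b => χ b ^ 2 * A b with hB
  -- §3: the three inner products in terms of `⟨∂B,∂A⟩ + ⟨∂*B,∂*A⟩`
  have h19 := inner_deltaAE_eq D c w B A
  have hH := inner_curl_add_diverg c B A
  -- §2: `⟨∂B,∂A⟩ + ⟨∂*B,∂*A⟩ = Σ_μ Σ_x B_μ ΔA_μ = Σ_μ Σ_ν Σ_x ∂_νB_μ ∂_νA_μ`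
  have hP := sum_mul_laplace_eq_curl_add_diverg c (WithLp.ofLp B) (WithLp.ofLp A)
  -- §1 per component and direction
  have hI : ∀ (ν μ : Fin P.d), ∑ x : Site P 0, (c * (χ ⟨x.shift ν, μ⟩ * A ⟨x.shift ν, μ⟩ - χ ⟨x, μ⟩ * A ⟨x, μ⟩)) ^ 2 =
      ∑ x : Site P 0, (χ ⟨x, μ⟩ ^ 2 * A ⟨x, μ⟩) * pdiffAdj c ν (pdiff c ν fun z => A ⟨z, μ⟩) x +
        ∑ x : Site P 0, c ^ 2 * (χ ⟨x.shift ν, μ⟩ - χ ⟨x, μ⟩) ^ 2 * (A ⟨x, μ⟩ * A ⟨x.shift ν, μ⟩) := by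
    intro ν μ
    have := sum_sq_pdiff_mul c ν (fun z => χ ⟨z, μ⟩) (fun z => A ⟨z, μ⟩)
    simpa only [pdiff, smul_eq_mul] using this
  -- assemble: rewrite the bond sums as (site, direction) sums
  have hLHS : ∑ ν : Fin P.d, ∑ b : PBond P 0, (c * (χ ⟨b.src.shift ν, b.dir⟩ * A ⟨b.src.shift ν, b.dir⟩ - χ b * A b)) ^ 2 =
      ∑ ν : Fin P.d, ∑ μ : Fin P.d, ∑ x : Site P 0, (c * (χ ⟨x.shift ν, μ⟩ * A ⟨x.shift ν, μ⟩ - χ ⟨x, μ⟩ * A ⟨x, μ⟩)) ^ 2 := by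
    refine Finset.sum_congr rfl fun ν _ => ?_
    rw [sum_bond_eq', Finset.sum_comm]
  have hE : ∑ ν : Fin P.d, ∑ b : PBond P 0, c ^ 2 * (χ ⟨b.src.shift ν, b.dir⟩ - χ b) ^ 2 * (A b * A ⟨b.src.shift ν, b.dir⟩) =
      ∑ ν : Fin P.d, ∑ μ : Fin P.d, ∑ x : Site P 0, c ^ 2 * (χ ⟨x.shift ν, μ⟩ - χ ⟨x, μ⟩) ^ 2 * (A ⟨x, μ⟩ * A ⟨x.shift ν, μ⟩) := by
    refine Finset.sum_congr rfl fun ν _ => ?_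
    rw [sum_bond_eq', Finset.sum_comm]
  -- the main term: Σ_ν Σ_μ Σ_x (χ²A)_μ ∂*_ν∂_ν A_μ = Σ_μ Σ_x B_μ ΔA_μ
  have hM : ∑ ν : Fin P.d, ∑ μ : Fin P.d, ∑ x : Site P 0, (χ ⟨x, μ⟩ ^ 2 * A ⟨x, μ⟩) * pdiffAdj c ν (pdiff c ν fun z => A ⟨z, μ⟩) x =
      ∑ μ : Fin P.d, ∑ x : Site P 0, (WithLp.ofLp B) ⟨x, μ⟩ * laplace c (fun z => (WithLp.ofLp A) ⟨z, μ⟩) x := by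
    rw [Finset.sum_comm]
    refine Finset.sum_congr rfl fun μ _ => ?_
    simp only [laplace_apply, Finset.mul_sum]
    rw [Finset.sum_comm]
  rw [hLHS, hE]
  simp only [hI, Finset.sum_add_distrib]
  rw [hM, hP, ← hH, h19]
  ring

/-- **COROLLARY (the inequality form)**: with `|χ(b+e_ν) − χ(b)| ≤ δ` on every fine bond and direction,
`Σ_ν Σ_b (c((χA)(b+e_ν) − (χA)(b)))² ≤ |⟨χ²A, Δ_aA⟩| + |⟨χ²A, ∂(1−R)∂*A⟩| + |⟨Q(χ²A), aQA⟩| + c²δ²·Σ_ν Σ_{b : χ(b+e_ν) ≠ χ(b)} |A(b)A(b+e_ν)|`.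
[cite: Balaban1984PropagatorsII, (2.19) p.226; folklore (IMS localisation)] -/
theorem ims_deltaAE_le (D : Domains P) (c : ℝ) (w : BondIdx D → ℝ) (A : BondSpace P) (χ : PBond P 0 → ℝ) {δ : ℝ}
    (hδ : ∀ (ν : Fin P.d) (b : PBond P 0), |χ ⟨b.src.shift ν, b.dir⟩ - χ b| ≤ δ) :
    ∑ ν : Fin P.d, ∑ b : PBond P 0, (c * (χ ⟨b.src.shift ν, b.dir⟩ * A ⟨b.src.shift ν, b.dir⟩ - χ b * A b)) ^ 2 ≤
      |⟪(WithLp.toLp 2 fun b => χ b ^ 2 * A b : BondSpace P), deltaAE D c w A⟫_ℝ| +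
      |⟪(WithLp.toLp 2 fun b => χ b ^ 2 * A b : BondSpace P), (dE c ∘ₗ (LinearMap.id - RE D c) ∘ₗ dsE c) A⟫_ℝ| +
      |⟪QE D (WithLp.toLp 2 fun b => χ b ^ 2 * A b : BondSpace P), aE D w (QE D A)⟫_ℝ| +
      c ^ 2 * δ ^ 2 * ∑ ν : Fin P.d, ∑ b : PBond P 0,
        (if χ ⟨b.src.shift ν, b.dir⟩ = χ b then 0 else |A b * A ⟨b.src.shift ν, b.dir⟩|) := by
  classical
  rw [ims_deltaAE D c w A χ]
  have hE : ∑ ν : Fin P.d, ∑ b : PBond P 0, c ^ 2 * (χ ⟨b.src.shift ν, b.dir⟩ - χ b) ^ 2 * (A b * A ⟨b.src.shift ν, b.dir⟩) ≤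
      c ^ 2 * δ ^ 2 * ∑ ν : Fin P.d, ∑ b : PBond P 0,
        (if χ ⟨b.src.shift ν, b.dir⟩ = χ b then 0 else |A b * A ⟨b.src.shift ν, b.dir⟩|) := by
    rw [Finset.mul_sum]
    refine Finset.sum_le_sum fun ν _ => ?_
    rw [Finset.mul_sum]
    refine Finset.sum_le_sum fun b _ => ?_
    split_ifs with h
    · rw [h, sub_self]; simp
    · have h1 : (χ ⟨b.src.shift ν, b.dir⟩ - χ b) ^ 2 ≤ δ ^ 2 := by
        have := hδ ν b
        rw [← sq_abs]
        exact pow_le_pow_left₀ (abs_nonneg _) this 2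
      calc c ^ 2 * (χ ⟨b.src.shift ν, b.dir⟩ - χ b) ^ 2 * (A b * A ⟨b.src.shift ν, b.dir⟩)
          ≤ c ^ 2 * (χ ⟨b.src.shift ν, b.dir⟩ - χ b) ^ 2 * |A b * A ⟨b.src.shift ν, b.dir⟩| :=
            mul_le_mul_of_nonneg_left (le_abs_self _) (by positivity)
        _ ≤ c ^ 2 * δ ^ 2 * |A b * A ⟨b.src.shift ν, b.dir⟩| :=
            mul_le_mul_of_nonneg_right (mul_le_mul_of_nonneg_left h1 (sq_nonneg c)) (abs_nonneg _)
  have h3 := le_abs_self ⟪(WithLp.toLp 2 fun b => χ b ^ 2 * A b : BondSpace P), deltaAE D c w A⟫_ℝ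
  have h4 := le_abs_self ⟪(WithLp.toLp 2 fun b => χ b ^ 2 * A b : BondSpace P), (dE c ∘ₗ (LinearMap.id - RE D c) ∘ₗ dsE c) A⟫_ℝ
  have h5 := neg_abs_le ⟪QE D (WithLp.toLp 2 fun b => χ b ^ 2 * A b : BondSpace P), aE D w (QE D A)⟫_ℝ
  linarith

end

end Literature.MathematicalPhysics.QuantumFieldTheory.Balaban1983to89.B6VecIMSV1
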